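import Summits.AtomisticToContinuum.FouriersLaw.Theses.HiddenChargeMazur
import Summits.AtomisticToContinuum.FouriersLaw.Theorems.OddSectorIrreversibilityCorrectorTheoryUniformMixing
import Summits.AtomisticToContinuum.FouriersLaw.Theorems.OddSectorIrreversibilityCorrectorPairingGreenKubo

/-!
# `HiddenChargeMazur.OpenMazurBridge`, part 1: the dressed pairing identity

Helper file (`--supports` stmt-AtomisticToContinuum-13513, route `HiddenChargeMazur`, sub-problem `FouriersLaw`,
summit `AtomisticToContinuum`). For the pinned anharmonic chain `pinnedChain ω₂ lam β γ` (`ω₂ > 0`, `lam, β ≥ 0`)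
at temperature `T > 0`, `ρ = e^{-H/T}`, a classical solution `u ∈ C²` of the Poisson equation `L_{T,T} u = -k`
and a DRESSED test function `G ∈ C²` — `X_H G = T (∂*_{p_{b₀}} w_L + ∂*_{p_{b₁}} w_R)` pointwise, `b₀ = 0`,
`b₁ = N - 1`, `∂*_p = -∂_p + p/T` the `ρ dp`-adjoint of `∂_p`, `w_L, w_R ∈ C¹`:

* `integral_chi_mul_creation` — Gaussian integration by parts against the creation operator at cutoff level,
  `∫ χ_n f ∂*_{p_b} w ρ = ∫ χ_n ∂_{p_b} f w ρ + ∫ ∂_{p_b} χ_n f w ρ`;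
* `integral_chi_source_mul_dressed` — `∫ χ_n k G ρ = T Σ_b (∫ χ_n ∂_b u w_b ρ + ∫ ∂_b χ_n u w_b ρ)
  + γ T Σ_b (∫ χ_n ∂_b G ∂_b u ρ + ∫ G ∂_b χ_n ∂_b u ρ)` (`-L = -X_H - γS`: antisymmetry of `X_H` and the two-tap
  Dirichlet form at cutoff level, from the energy-cutoff Green calculus `JunctionLocalitySuperadditiveResistanceKubo*`);
* `integral_source_mul_dressed` — `n → ∞`: **`∫ k G ρ = T Σ_b ∫ ∂_{p_b} u (w_b + γ ∂_{p_b} G) ρ`**, i.e.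
  `⟨-Lu, G⟩_ρ = T Σ_b ⟨∂_b u, w_b + γ ∂_b G⟩_ρ`, under the natural `L¹(ρ)` conditions — the integration-by-parts
  step of the one-sided Thomson (Mazur–Drude) bound for dressed test functions, with NO pointwise gradient bound
  on `u` (only `∂_{p_b} u ∈ L²(ρ)` is used downstream).

No definitions; nothing here closes an item. References: Komorowski–Landim–Olla 2012 (Ch. 2, variational
formulas / sector condition), Eckmann–Pillet–Rey-Bellet 1999 §3.
-/

noncomputable section

open MeasureTheory Filter Topology ProbabilityTheory
open scoped ContDiff NNReal ENNReal
open Literature.MathematicalPhysics.KineticTheory.HeatConduction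
open Summit.AtomisticToContinuum.FouriersLaw.Theorems.SuperadditiveResistance.DeviceLiouville
open Summit.AtomisticToContinuum.FouriersLaw.Theorems.SuperadditiveResistance.Kubo
open Summit.AtomisticToContinuum.FouriersLaw.Theorems.OddSectorIrreversibility.Corrector

namespace Summit.AtomisticToContinuum.FouriersLaw.Theorems.HiddenChargeMazur

variable {N : ℕ}

section Pinned

variable {ω₂ lam β γ : ℝ} (hω : 0 < ω₂) (hl : 0 ≤ lam) (hβ : 0 ≤ β) {T : ℝ} (hT : 0 < T)
include hω hl hβ hT

omit hT in
/-- **Gaussian integration by parts against the creation operator at a bath site, cutoff level.**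
For `f, w ∈ C¹`, the energy cutoff `χ_n` and `ρ = e^{-H/T}`:
`∫ χ_n f (-∂_{p_b} w + (p_b/T) w) ρ = ∫ χ_n (∂_{p_b} f) w ρ + ∫ (∂_{p_b} χ_n) f w ρ`
(`∂*_{p_b} = -∂_{p_b} + p_b/T` is the `ρ dp_b`-adjoint of `∂_{p_b}`; the test function `χ_n f` has
compact support, so no growth condition on `f`, `w` is needed). [folklore] -/
theorem integral_chi_mul_creation (b : Fin N) {f w : PhaseSpace N → ℝ} (hf : ContDiff ℝ 1 f)
    (hw : ContDiff ℝ 1 w) (n : ℕ) :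
    ∫ x, chi (pinnedChain ω₂ lam β γ) N n x * f x *
        (-partialP b w x + x.2 b / T * w x) * (pinnedChain ω₂ lam β γ).gibbsDensity N T x =
      (∫ x, chi (pinnedChain ω₂ lam β γ) N n x * partialP b f x * w x *
          (pinnedChain ω₂ lam β γ).gibbsDensity N T x) +
        ∫ x, partialP b (chi (pinnedChain ω₂ lam β γ) N n) x * f x * w x *
          (pinnedChain ω₂ lam β γ).gibbsDensity N T x := by
  set P := pinnedChain ω₂ lam β γ with hP
  set ρ := P.gibbsDensity N T with hρ
  set χ := chi P N n with hχ
  have hU := pinnedChain_contDiff_U ω₂ lam β γ (n := ∞)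
  have hV := pinnedChain_contDiff_V ω₂ lam β γ (n := ∞)
  have hHs : ContDiff ℝ ∞ (P.hamiltonian N) := P.contDiff_hamiltonian hU hV N
  have hχs : ContDiff ℝ ∞ χ := contDiff_chi hHs n
  have hχ1 : ContDiff ℝ 1 χ := hχs.of_le (by norm_cast)
  have hχd : Differentiable ℝ χ := hχ1.differentiable one_ne_zero
  have hχc : HasCompactSupport χ := hasCompactSupport_chi hω hl hβ γ N n
  have hfd : Differentiable ℝ f := hf.differentiable one_ne_zero
  have hwd : Differentiable ℝ w := hw.differentiable one_ne_zero
  have hρc : Continuous ρ := P.continuous_gibbsDensity hU.continuous hV.continuous N T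
  have hχfc1 : ContDiff ℝ 1 (fun y => χ y * f y) := hχ1.mul hf
  have hχfd : Differentiable ℝ (fun y => χ y * f y) := hχfc1.differentiable one_ne_zero
  have hχf_cs : HasCompactSupport (fun y => χ y * f y) := hχc.mul_right
  -- continuity facts
  have hχC : Continuous χ := hχ1.continuous
  have hdχC : Continuous (partialP b χ) := continuous_partialP hχ1 one_ne_zero b
  have hfC : Continuous f := hf.continuous
  have hdfC : Continuous (partialP b f) := continuous_partialP hf one_ne_zero b
  have hwC : Continuous w := hw.continuous
  have hdwC : Continuous (partialP b w) := continuous_partialP hw one_ne_zero b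
  have hdχfC : Continuous (partialP b (fun y => χ y * f y)) := continuous_partialP hχfc1 one_ne_zero b
  have hdχ_cs : HasCompactSupport (partialP b χ) := hasCompactSupport_partialP hχd hχc b
  have hdχf_cs : HasCompactSupport (partialP b (fun y => χ y * f y)) :=
    hasCompactSupport_partialP hχfd hχf_cs b
  -- the test function `g = χ f ρ` and its `p_b`-derivative
  set g : PhaseSpace N → ℝ := fun x => χ x * f x * ρ x with hg
  set g' : PhaseSpace N → ℝ := fun x =>
    partialP b (fun y => χ y * f y) x * ρ x - χ x * f x * (x.2 b / T) * ρ x with hg'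
  have hgC : Continuous g := (hχC.mul hfC).mul hρc
  have hg'C : Continuous g' := by
    have : Continuous fun x : PhaseSpace N => x.2 b / T := by fun_prop
    exact (hdχfC.mul hρc).sub (((hχC.mul hfC).mul this).mul hρc)
  have hg_cs : HasCompactSupport g := (hχc.mul_right).mul_right
  have hg'_cs : HasCompactSupport g' := (hdχf_cs.mul_right).sub ((hχc.mul_right).mul_right.mul_right)
  have hgd : ∀ x, HasLineDerivAt ℝ g (g' x) x ((0, Pi.single b 1) : PhaseSpace N) := by
    intro x
    have hρ' := P.hasLineDerivAt_gibbsDensity (T := T) (P.hasLineDerivAt_hamiltonian_unitP N x b)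
    have h1 := hasLineDerivAt_partialP hχfd b x
    unfold HasLineDerivAt at hρ' h1 ⊢
    have h2 := h1.mul hρ'
    simp only [zero_smul, add_zero] at h2
    refine h2.congr_deriv ?_
    simp only [hg']
    ring
  have hwd' : ∀ x, HasLineDerivAt ℝ w (partialP b w x) x ((0, Pi.single b 1) : PhaseSpace N) :=
    fun x => hasLineDerivAt_partialP hwd b x
  have e := integral_mul_eq_neg_of_hasLineDerivAt hwC hdwC hgC hg'C hg_cs hg'_cs hwd' hgd
  -- expand `∂_{p_b}(χ f) = ∂χ f + χ ∂f`
  have hprod : ∀ x, partialP b (fun y => χ y * f y) x = partialP b χ x * f x + χ x * partialP b f x :=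
    fun x => partialP_mul hχd hfd b x
  -- integrability of the pieces (continuous, compact support)
  have i1 : Integrable fun x => χ x * partialP b f x * w x * ρ x :=
    Continuous.integrable_of_hasCompactSupport (by fun_prop) ((hχc.mul_right).mul_right.mul_right)
  have i2 : Integrable fun x => partialP b χ x * f x * w x * ρ x :=
    Continuous.integrable_of_hasCompactSupport (by fun_prop) ((hdχ_cs.mul_right).mul_right.mul_right)
  have i3 : Integrable fun x => χ x * f x * (x.2 b / T * w x) * ρ x := by
    have : Continuous fun x : PhaseSpace N => x.2 b / T * w x := by fun_prop
    exact Continuous.integrable_of_hasCompactSupport (by fun_prop) ((hχc.mul_right).mul_right.mul_right)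
  have i4 : Integrable fun x => χ x * f x * partialP b w x * ρ x :=
    Continuous.integrable_of_hasCompactSupport (by fun_prop) ((hχc.mul_right).mul_right.mul_right)
  -- rewrite both sides of `e`
  have eL : ∫ x, w x * g' x = (∫ x, partialP b χ x * f x * w x * ρ x) +
      (∫ x, χ x * partialP b f x * w x * ρ x) - ∫ x, χ x * f x * (x.2 b / T * w x) * ρ x := by
    have : (fun x => w x * g' x) = fun x => (partialP b χ x * f x * w x * ρ x +
        χ x * partialP b f x * w x * ρ x) - χ x * f x * (x.2 b / T * w x) * ρ x := by
      funext x; simp only [hg', hprod]; ring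
    have i21 : Integrable fun x => partialP b χ x * f x * w x * ρ x + χ x * partialP b f x * w x * ρ x :=
      i2.add i1
    rw [this, integral_sub i21 i3, integral_add i2 i1]
  have eR : ∫ x, partialP b w x * g x = ∫ x, χ x * f x * partialP b w x * ρ x := by
    refine integral_congr_ae (ae_of_all _ fun x => ?_)
    simp only [hg]; ring
  rw [eL, eR] at e
  have hsplit : (fun x => χ x * f x * (-partialP b w x + x.2 b / T * w x) * ρ x) = fun x =>
      χ x * f x * (x.2 b / T * w x) * ρ x - χ x * f x * partialP b w x * ρ x := by
    funext x; ring
  rw [hsplit, integral_sub i3 i4]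
  linarith


omit hω hl hβ hT in
/-- Collapse of a two-bath `if`-sum to the two bath sites `b₀ = 0`, `b₁ = N - 1` (they coincide when
`N = 1`). [folklore] -/
theorem sum_ite_bath (a c : Fin N → ℝ) {b₀ b₁ : Fin N} (hb₀ : b₀.val = 0) (hb₁ : b₁.val = N - 1) :
    ∑ i : Fin N, ((if i.val = 0 then a i else 0) + (if i.val = N - 1 then c i else 0)) =
      a b₀ + c b₁ := by
  rw [Finset.sum_add_distrib]
  congr 1
  · rw [Finset.sum_eq_single_of_mem b₀ (Finset.mem_univ _)]
    · rw [if_pos hb₀]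
    · intro b _ hb
      rw [if_neg]
      exact fun h => hb (Fin.ext (by omega))
  · rw [Finset.sum_eq_single_of_mem b₁ (Finset.mem_univ _)]
    · rw [if_pos hb₁]
    · intro b _ hb
      rw [if_neg]
      exact fun h => hb (Fin.ext (by omega))

/-- **The dressed pairing identity at cutoff level.** For the pinned chain at temperature `T`, a
classical solution `u ∈ C²` of the Poisson equation `L_{T,T} u = -k`, a DRESSED `G ∈ C²`
(`X_H G = T (∂*_{p_{b₀}} w_L + ∂*_{p_{b₁}} w_R)` with `w_L, w_R ∈ C¹`, `∂*_p = -∂_p + p/T`) and every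
energy cutoff `χ_n`:
`∫ χ_n k G ρ = T Σ_b (∫ χ_n ∂_b u w_b ρ + ∫ ∂_b χ_n u w_b ρ) + γ T Σ_b (∫ χ_n ∂_b G ∂_b u ρ + ∫ G ∂_b χ_n ∂_b u ρ)`
(`-L = -X_H - γ S`; `X_H` is antisymmetric and `S` is the two-tap Dirichlet form at cutoff level, and the
creation operators are moved onto `χ_n u`). [folklore] -/
theorem integral_chi_source_mul_dressed {u k G wL wR : PhaseSpace N → ℝ} (hu : ContDiff ℝ 2 u)
    (hG : ContDiff ℝ 2 G) (hwL : ContDiff ℝ 1 wL) (hwR : ContDiff ℝ 1 wR)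
    (hpde : ∀ x, (pinnedChain ω₂ lam β γ).generator N T T u x = -k x)
    {b₀ b₁ : Fin N} (hb₀ : b₀.val = 0) (hb₁ : b₁.val = N - 1)
    (hXG : ∀ x, liouvilleOp (pinnedChain ω₂ lam β γ) N G x =
      T * ((-partialP b₀ wL x + x.2 b₀ / T * wL x) + (-partialP b₁ wR x + x.2 b₁ / T * wR x)))
    (n : ℕ) :
    ∫ x, chi (pinnedChain ω₂ lam β γ) N n x * (k x * G x) * (pinnedChain ω₂ lam β γ).gibbsDensity N T x =
      T * (((∫ x, chi (pinnedChain ω₂ lam β γ) N n x * (partialP b₀ u x * wL x) *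
              (pinnedChain ω₂ lam β γ).gibbsDensity N T x) +
            ∫ x, partialP b₀ (chi (pinnedChain ω₂ lam β γ) N n) x * (u x * wL x) *
              (pinnedChain ω₂ lam β γ).gibbsDensity N T x) +
          ((∫ x, chi (pinnedChain ω₂ lam β γ) N n x * (partialP b₁ u x * wR x) *
              (pinnedChain ω₂ lam β γ).gibbsDensity N T x) +
            ∫ x, partialP b₁ (chi (pinnedChain ω₂ lam β γ) N n) x * (u x * wR x) *
              (pinnedChain ω₂ lam β γ).gibbsDensity N T x)) +
      γ * T * (((∫ x, chi (pinnedChain ω₂ lam β γ) N n x * (partialP b₀ G x * partialP b₀ u x) *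
              (pinnedChain ω₂ lam β γ).gibbsDensity N T x) +
            ∫ x, partialP b₀ (chi (pinnedChain ω₂ lam β γ) N n) x * (G x * partialP b₀ u x) *
              (pinnedChain ω₂ lam β γ).gibbsDensity N T x) +
          ((∫ x, chi (pinnedChain ω₂ lam β γ) N n x * (partialP b₁ G x * partialP b₁ u x) *
              (pinnedChain ω₂ lam β γ).gibbsDensity N T x) +
            ∫ x, partialP b₁ (chi (pinnedChain ω₂ lam β γ) N n) x * (G x * partialP b₁ u x) *
              (pinnedChain ω₂ lam β γ).gibbsDensity N T x)) := by
  set P := pinnedChain ω₂ lam β γ with hP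
  set ρ := P.gibbsDensity N T with hρ
  set χ := chi P N n with hχ
  have hT0 : T ≠ 0 := hT.ne'
  have hU := pinnedChain_contDiff_U ω₂ lam β γ (n := ∞)
  have hV := pinnedChain_contDiff_V ω₂ lam β γ (n := ∞)
  have hHs : ContDiff ℝ ∞ (P.hamiltonian N) := P.contDiff_hamiltonian hU hV N
  have hχs : ContDiff ℝ ∞ χ := contDiff_chi hHs n
  have hχ1 : ContDiff ℝ 1 χ := hχs.of_le (by norm_cast)
  have hχd : Differentiable ℝ χ := hχ1.differentiable one_ne_zero
  have hχc : HasCompactSupport χ := hasCompactSupport_chi hω hl hβ γ N n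
  have hχC : Continuous χ := hχ1.continuous
  have hρc : Continuous ρ := P.continuous_gibbsDensity hU.continuous hV.continuous N T
  have hu1 : ContDiff ℝ 1 u := hu.of_le (by norm_cast)
  have hG1 : ContDiff ℝ 1 G := hG.of_le (by norm_cast)
  have huC : Continuous u := hu.continuous
  have hGC : Continuous G := hG.continuous
  have hXuC : Continuous (liouvilleOp P N u) :=
    Summit.AtomisticToContinuum.FouriersLaw.Theorems.SuperadditiveResistance.Kubo.continuous_liouvilleOp N hu
  have hXGC : Continuous (liouvilleOp P N G) :=
    Summit.AtomisticToContinuum.FouriersLaw.Theorems.SuperadditiveResistance.Kubo.continuous_liouvilleOp N hG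
  have hSuC : Continuous (bathOp N (OscillatorChain.bathWeight N) T u) :=
    Summit.AtomisticToContinuum.FouriersLaw.Theorems.SuperadditiveResistance.Kubo.continuous_bathOp N _ T hu
  have hγ' : P.γ = γ := rfl
  -- `k = -(X u + γ S u)` pointwise
  have hk : ∀ x, k x = -(liouvilleOp P N u x + γ * bathOp N (OscillatorChain.bathWeight N) T u x) := by
    intro x
    have h := hpde x
    rw [generator_eq_liouvilleOp_add, hγ'] at h
    linarith
  -- Step 1: split `∫ χ k G ρ`
  have iXu : Integrable fun x => χ x * (G x * liouvilleOp P N u x) * ρ x :=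
    Continuous.integrable_of_hasCompactSupport (by fun_prop) ((hχc.mul_right).mul_right)
  have iSu : Integrable fun x => χ x * G x * bathOp N (OscillatorChain.bathWeight N) T u x * ρ x :=
    Continuous.integrable_of_hasCompactSupport (by fun_prop) (((hχc.mul_right).mul_right).mul_right)
  have h1 : ∫ x, χ x * (k x * G x) * ρ x =
      -(∫ x, χ x * (G x * liouvilleOp P N u x) * ρ x) -
        γ * ∫ x, χ x * G x * bathOp N (OscillatorChain.bathWeight N) T u x * ρ x := by
    have : (fun x => χ x * (k x * G x) * ρ x) = fun x =>
        -(χ x * (G x * liouvilleOp P N u x) * ρ x) -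
          γ * (χ x * G x * bathOp N (OscillatorChain.bathWeight N) T u x * ρ x) := by
      funext x; rw [hk x]; ring
    have iXu' : Integrable fun x => -(χ x * (G x * liouvilleOp P N u x) * ρ x) := iXu.neg
    have iSu' : Integrable fun x => γ * (χ x * G x * bathOp N (OscillatorChain.bathWeight N) T u x * ρ x) :=
      iSu.const_mul γ
    rw [this, integral_sub iXu' iSu', integral_neg, integral_const_mul]
  -- Step 2: antisymmetry of `X_H` at cutoff level
  have h2 : ∫ x, χ x * (G x * liouvilleOp P N u x) * ρ x = -∫ x, χ x * (u x * liouvilleOp P N G x) * ρ x := by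
    have h0 := integral_chi_liouville_antisymm hω hl hβ γ N hT0 hG hu n
    have iuX : Integrable fun x => χ x * (u x * liouvilleOp P N G x) * ρ x :=
      Continuous.integrable_of_hasCompactSupport (by fun_prop) ((hχc.mul_right).mul_right)
    have hsplit : (fun x => χ x * (G x * liouvilleOp P N u x + u x * liouvilleOp P N G x) * ρ x) =
        fun x => χ x * (G x * liouvilleOp P N u x) * ρ x + χ x * (u x * liouvilleOp P N G x) * ρ x := by
      funext x; ring
    rw [hsplit, integral_add iXu iuX] at h0
    linarith
  -- Step 3: the dressing, then the creation operators are moved onto `χ u`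
  have iA0 : Integrable fun x => χ x * u x * (-partialP b₀ wL x + x.2 b₀ / T * wL x) * ρ x := by
    have : Continuous fun x : PhaseSpace N => -partialP b₀ wL x + x.2 b₀ / T * wL x := by
      have := continuous_partialP hwL one_ne_zero b₀
      have := hwL.continuous
      fun_prop
    exact Continuous.integrable_of_hasCompactSupport (by fun_prop) (((hχc.mul_right).mul_right).mul_right)
  have iA1 : Integrable fun x => χ x * u x * (-partialP b₁ wR x + x.2 b₁ / T * wR x) * ρ x := by
    have : Continuous fun x : PhaseSpace N => -partialP b₁ wR x + x.2 b₁ / T * wR x := by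
      have := continuous_partialP hwR one_ne_zero b₁
      have := hwR.continuous
      fun_prop
    exact Continuous.integrable_of_hasCompactSupport (by fun_prop) (((hχc.mul_right).mul_right).mul_right)
  have h3 : ∫ x, χ x * (u x * liouvilleOp P N G x) * ρ x =
      T * ((∫ x, χ x * u x * (-partialP b₀ wL x + x.2 b₀ / T * wL x) * ρ x) +
        ∫ x, χ x * u x * (-partialP b₁ wR x + x.2 b₁ / T * wR x) * ρ x) := by
    have : (fun x => χ x * (u x * liouvilleOp P N G x) * ρ x) = fun x =>
        T * (χ x * u x * (-partialP b₀ wL x + x.2 b₀ / T * wL x) * ρ x +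
          χ x * u x * (-partialP b₁ wR x + x.2 b₁ / T * wR x) * ρ x) := by
      funext x; rw [hXG x]; ring
    rw [this, integral_const_mul, integral_add iA0 iA1]
  have h4 := integral_chi_mul_creation hω hl hβ (γ := γ) (T := T) b₀ hu1 hwL n
  have h5 := integral_chi_mul_creation hω hl hβ (γ := γ) (T := T) b₁ hu1 hwR n
  -- Step 4: the two taps
  have h6 := integral_chi_mul_bathOp hω hl hβ γ N (OscillatorChain.bathWeight N) hT0 hG hu n
  rw [sum_bathWeight_mul _ hb₀ hb₁] at h6
  -- assemble (regroup the products inside the integrals)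
  have r1 : ∫ x, χ x * (partialP b₀ u x * wL x) * ρ x = ∫ x, χ x * partialP b₀ u x * wL x * ρ x :=
    integral_congr_ae (ae_of_all _ fun x => by ring)
  have r2 : ∫ x, partialP b₀ χ x * (u x * wL x) * ρ x = ∫ x, partialP b₀ χ x * u x * wL x * ρ x :=
    integral_congr_ae (ae_of_all _ fun x => by ring)
  have r3 : ∫ x, χ x * (partialP b₁ u x * wR x) * ρ x = ∫ x, χ x * partialP b₁ u x * wR x * ρ x :=
    integral_congr_ae (ae_of_all _ fun x => by ring)
  have r4 : ∫ x, partialP b₁ χ x * (u x * wR x) * ρ x = ∫ x, partialP b₁ χ x * u x * wR x * ρ x :=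
    integral_congr_ae (ae_of_all _ fun x => by ring)
  have r5 : ∫ x, χ x * (partialP b₀ G x * partialP b₀ u x) * ρ x =
      ∫ x, χ x * partialP b₀ G x * partialP b₀ u x * ρ x :=
    integral_congr_ae (ae_of_all _ fun x => by ring)
  have r6 : ∫ x, partialP b₀ χ x * (G x * partialP b₀ u x) * ρ x =
      ∫ x, G x * partialP b₀ χ x * partialP b₀ u x * ρ x :=
    integral_congr_ae (ae_of_all _ fun x => by ring)
  have r7 : ∫ x, χ x * (partialP b₁ G x * partialP b₁ u x) * ρ x =
      ∫ x, χ x * partialP b₁ G x * partialP b₁ u x * ρ x :=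
    integral_congr_ae (ae_of_all _ fun x => by ring)
  have r8 : ∫ x, partialP b₁ χ x * (G x * partialP b₁ u x) * ρ x =
      ∫ x, G x * partialP b₁ χ x * partialP b₁ u x * ρ x :=
    integral_congr_ae (ae_of_all _ fun x => by ring)
  rw [r1, r2, r3, r4, r5, r6, r7, r8, h1, h2, h3, h4, h5, h6]
  ring


/-- **The dressed pairing identity.** For the pinned chain at temperature `T > 0`, a classical
solution `u ∈ C²` of `L_{T,T} u = -k`, a dressed `G ∈ C²` (`X_H G = T(∂*_{p_{b₀}} w_L + ∂*_{p_{b₁}} w_R)`,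
`w_L, w_R ∈ C¹`), under the natural integrability conditions against `ρ = e^{-H/T}`:
`∫ k G ρ = T (∫ ∂_{p_{b₀}}u · w_L ρ + ∫ ∂_{p_{b₁}}u · w_R ρ) + γ T (∫ ∂_{p_{b₀}}G ∂_{p_{b₀}}u ρ + ∫ ∂_{p_{b₁}}G ∂_{p_{b₁}}u ρ)`,
i.e. `⟨-Lu, G⟩ = T Σ_b ⟨∂_b u, w_b + γ ∂_b G⟩`: the cutoff-level identity
`integral_chi_source_mul_dressed` and `n → ∞` (`χ_n → 1`, `∂χ_n → 0`, dominated convergence).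
This is the integration-by-parts step of the one-sided Thomson (Mazur–Drude) bound for DRESSED test
functions. [cite: KomorowskiLandimOlla2012, Ch. 2] -/
theorem integral_source_mul_dressed {u k G wL wR : PhaseSpace N → ℝ} (hu : ContDiff ℝ 2 u)
    (hk : Continuous k) (hG : ContDiff ℝ 2 G) (hwL : ContDiff ℝ 1 wL) (hwR : ContDiff ℝ 1 wR)
    (hpde : ∀ x, (pinnedChain ω₂ lam β γ).generator N T T u x = -k x)
    {b₀ b₁ : Fin N} (hb₀ : b₀.val = 0) (hb₁ : b₁.val = N - 1)
    (hXG : ∀ x, liouvilleOp (pinnedChain ω₂ lam β γ) N G x =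
      T * ((-partialP b₀ wL x + x.2 b₀ / T * wL x) + (-partialP b₁ wR x + x.2 b₁ / T * wR x)))
    (ikG : Integrable fun x => k x * G x * (pinnedChain ω₂ lam β γ).gibbsDensity N T x)
    (i0w : Integrable fun x => partialP b₀ u x * wL x * (pinnedChain ω₂ lam β γ).gibbsDensity N T x)
    (i1w : Integrable fun x => partialP b₁ u x * wR x * (pinnedChain ω₂ lam β γ).gibbsDensity N T x)
    (i0u : Integrable fun x => u x * wL x * (pinnedChain ω₂ lam β γ).gibbsDensity N T x)
    (i1u : Integrable fun x => u x * wR x * (pinnedChain ω₂ lam β γ).gibbsDensity N T x)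
    (i0G : Integrable fun x => partialP b₀ G x * partialP b₀ u x * (pinnedChain ω₂ lam β γ).gibbsDensity N T x)
    (i1G : Integrable fun x => partialP b₁ G x * partialP b₁ u x * (pinnedChain ω₂ lam β γ).gibbsDensity N T x)
    (i0Gu : Integrable fun x => G x * partialP b₀ u x * (pinnedChain ω₂ lam β γ).gibbsDensity N T x)
    (i1Gu : Integrable fun x => G x * partialP b₁ u x * (pinnedChain ω₂ lam β γ).gibbsDensity N T x) :
    ∫ x, k x * G x * (pinnedChain ω₂ lam β γ).gibbsDensity N T x =
      T * ((∫ x, partialP b₀ u x * wL x * (pinnedChain ω₂ lam β γ).gibbsDensity N T x) +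
          ∫ x, partialP b₁ u x * wR x * (pinnedChain ω₂ lam β γ).gibbsDensity N T x) +
      γ * T * ((∫ x, partialP b₀ G x * partialP b₀ u x * (pinnedChain ω₂ lam β γ).gibbsDensity N T x) +
          ∫ x, partialP b₁ G x * partialP b₁ u x * (pinnedChain ω₂ lam β γ).gibbsDensity N T x) := by
  set P := pinnedChain ω₂ lam β γ with hP
  set ρ := P.gibbsDensity N T with hρ
  have hu1 : ContDiff ℝ 1 u := hu.of_le (by norm_cast)
  have hG1 : ContDiff ℝ 1 G := hG.of_le (by norm_cast)
  have huC : Continuous u := hu.continuous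
  have hGC : Continuous G := hG.continuous
  have hwLC : Continuous wL := hwL.continuous
  have hwRC : Continuous wR := hwR.continuous
  have hdu : ∀ b, Continuous (partialP b u) := fun b => continuous_partialP hu1 one_ne_zero b
  have hdG : ∀ b, Continuous (partialP b G) := fun b => continuous_partialP hG1 one_ne_zero b
  -- the limits of the nine cutoff sequences
  have hL : Tendsto (fun n : ℕ => ∫ x, chi P N n x * (k x * G x) * ρ x) atTop
      (𝓝 (∫ x, k x * G x * ρ x)) :=
    tendsto_integral_chi_mul hω.le hl hβ γ N T (hk.mul hGC).aestronglyMeasurable ikG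
  have hA0 : Tendsto (fun n : ℕ => ∫ x, chi P N n x * (partialP b₀ u x * wL x) * ρ x) atTop
      (𝓝 (∫ x, partialP b₀ u x * wL x * ρ x)) :=
    tendsto_integral_chi_mul hω.le hl hβ γ N T ((hdu b₀).mul hwLC).aestronglyMeasurable i0w
  have hA1 : Tendsto (fun n : ℕ => ∫ x, chi P N n x * (partialP b₁ u x * wR x) * ρ x) atTop
      (𝓝 (∫ x, partialP b₁ u x * wR x * ρ x)) :=
    tendsto_integral_chi_mul hω.le hl hβ γ N T ((hdu b₁).mul hwRC).aestronglyMeasurable i1w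
  have hB0 : Tendsto (fun n : ℕ => ∫ x, partialP b₀ (chi P N n) x * (u x * wL x) * ρ x) atTop (𝓝 0) :=
    tendsto_integral_partialP_chi_mul hω hl hβ γ N T b₀ (huC.mul hwLC).aestronglyMeasurable i0u
  have hB1 : Tendsto (fun n : ℕ => ∫ x, partialP b₁ (chi P N n) x * (u x * wR x) * ρ x) atTop (𝓝 0) :=
    tendsto_integral_partialP_chi_mul hω hl hβ γ N T b₁ (huC.mul hwRC).aestronglyMeasurable i1u
  have hC0 : Tendsto (fun n : ℕ => ∫ x, chi P N n x * (partialP b₀ G x * partialP b₀ u x) * ρ x) atTop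
      (𝓝 (∫ x, partialP b₀ G x * partialP b₀ u x * ρ x)) :=
    tendsto_integral_chi_mul hω.le hl hβ γ N T ((hdG b₀).mul (hdu b₀)).aestronglyMeasurable i0G
  have hC1 : Tendsto (fun n : ℕ => ∫ x, chi P N n x * (partialP b₁ G x * partialP b₁ u x) * ρ x) atTop
      (𝓝 (∫ x, partialP b₁ G x * partialP b₁ u x * ρ x)) :=
    tendsto_integral_chi_mul hω.le hl hβ γ N T ((hdG b₁).mul (hdu b₁)).aestronglyMeasurable i1G
  have hD0 : Tendsto (fun n : ℕ => ∫ x, partialP b₀ (chi P N n) x * (G x * partialP b₀ u x) * ρ x) atTop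
      (𝓝 0) :=
    tendsto_integral_partialP_chi_mul hω hl hβ γ N T b₀ (hGC.mul (hdu b₀)).aestronglyMeasurable i0Gu
  have hD1 : Tendsto (fun n : ℕ => ∫ x, partialP b₁ (chi P N n) x * (G x * partialP b₁ u x) * ρ x) atTop
      (𝓝 0) :=
    tendsto_integral_partialP_chi_mul hω hl hβ γ N T b₁ (hGC.mul (hdu b₁)).aestronglyMeasurable i1Gu
  have hR := (((hA0.add hB0).add (hA1.add hB1)).const_mul T).add
    ((((hC0.add hD0).add (hC1.add hD1)).const_mul (γ * T)))
  simp only [add_zero] at hR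
  have heq : ∀ n : ℕ, ∫ x, chi P N n x * (k x * G x) * ρ x =
      T * (((∫ x, chi P N n x * (partialP b₀ u x * wL x) * ρ x) +
            ∫ x, partialP b₀ (chi P N n) x * (u x * wL x) * ρ x) +
          ((∫ x, chi P N n x * (partialP b₁ u x * wR x) * ρ x) +
            ∫ x, partialP b₁ (chi P N n) x * (u x * wR x) * ρ x)) +
      γ * T * (((∫ x, chi P N n x * (partialP b₀ G x * partialP b₀ u x) * ρ x) +
            ∫ x, partialP b₀ (chi P N n) x * (G x * partialP b₀ u x) * ρ x) +
          ((∫ x, chi P N n x * (partialP b₁ G x * partialP b₁ u x) * ρ x) +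
            ∫ x, partialP b₁ (chi P N n) x * (G x * partialP b₁ u x) * ρ x)) :=
    fun n => integral_chi_source_mul_dressed hω hl hβ hT hu hG hwL hwR hpde hb₀ hb₁ hXG n
  exact tendsto_nhds_unique (hL.congr heq) hR

end Pinned

end Summit.AtomisticToContinuum.FouriersLaw.Theorems.HiddenChargeMazur

end
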